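import Mathlib
import Literature.Analysis.FluidPDE.NSForcedEnstrophyOfSupNorm
import Literature.Analysis.FluidPDE.TaoEnstrophyLocalisationProofs
import Literature.Analysis.FluidPDE.EnstrophyGronwall
import Literature.Claims.NS.ClayVariants
import HarnessLib

/-!
# `WindowToSlice` — tools (helper for the shelf crux stmt-NavierStokesRegularity-1574
  `EnstrophyQuarterLaw`, stub `stub_windowToSlice` of `Cruxes/EnstrophyQuarterLaw/Lines/window_average.lean`
  and `Lines/sparse_sieve.lean`; part 1 of 2, see `StretchingWellBindingEnstrophyQuarterLawWindowToSlice.lean`)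

The one analytic input of the converter «sup-norm Type I + window quarter law ⇒ slice quarter law»:

* `WindowToSlice.exists_enstrophy_rate` — **Serrin's enstrophy inequality at the endpoint `(2, ∞)`,
  pressure-free and quantitative**: for `ν > 0` there is `κ = κ(ν) ≥ 0` such that every classical
  solution `(u, p)` of the UNFORCED Navier–Stokes system on a closed slab `[0, S] × ℝ³` lying in Tao's
  class (`HasBoundedSobolevNormsOn`) with `|u| ≤ M` on the slab obeys
  `∫ |∇u(s)|² ≤ e^{κ M² s} ∫ |∇u(0)|²`, `s ∈ [0, S]` (Lemarié-Rieusset 2016, Thm. 11.2, (11.11) at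
  `r = ∞`). It is the tree's chained piece bound `ForcedEnstrophyOfSupNorm.exists_piece_rate` (the slab
  inequality applied to Tao's re-gauged local solution `tao2011_smooth_local_existence_forced_holds`, so
  that NO hypothesis on the pressure is needed) with force `0` along a uniform partition of `[0, s]` —
  verbatim the induction of the tree's `exists_enstrophy_le_of_norm_le_forced`, keeping the explicit rate
  instead of packaging a uniform constant;
* zero-force bookkeeping (the tree's `ClayVariants.isSmoothOnHalfSpace_zero` / `hasRapidSpaceTimeDecay_zero`), the `H¹` packaging `H1_pack`, the uniform step, and the pointwise / slice
  comparison `|curl v|² ≤ ‖curlCLM‖² |∇v|²_F` (`enorm_curl_sq_le`, `lintegral_enorm_curl_sq_le`).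

HONEST FRAMING: a-priori estimates for GIVEN classical solutions; nothing here bears on the regularity
problem itself and no summit statement is proved.
-/

noncomputable section

set_option linter.dupNamespace false

namespace Summit.NavierStokesRegularity.NavierStokesRegularity.Theorems

open MeasureTheory Set Filter Topology Function Literature.Analysis.FluidPDE
open scoped NNReal ENNReal ContDiff

namespace WindowToSlice

/-! ### Zero-force bookkeeping -/

/-- The zero force has vanishing Sobolev slices: `∫ ‖Dⁿ 0‖² ≤ 0`. [folklore] -/
theorem lintegral_iteratedFDeriv_zero_force_le (n : ℕ) (t : ℝ) :
    ∫⁻ x, ‖iteratedFDeriv ℝ n ((0 : ℝ → EuclideanSpace ℝ (Fin 3) → EuclideanSpace ℝ (Fin 3)) t) x‖ₑ ^ 2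
      ≤ ((0 : ℝ≥0) : ℝ≥0∞) := by
  simp [iteratedFDeriv_zero]

/-- The zero force has vanishing `H¹` slices (the `B = 0` input of Tao's local existence theorem).
[folklore] -/
theorem H1_zero_force_le (t : ℝ) :
    (∫⁻ x, ‖(0 : ℝ → EuclideanSpace ℝ (Fin 3) → EuclideanSpace ℝ (Fin 3)) t x‖ₑ ^ 2) +
      (∫⁻ x, ENNReal.ofReal (frobeniusNormSq
        (fderiv ℝ ((0 : ℝ → EuclideanSpace ℝ (Fin 3) → EuclideanSpace ℝ (Fin 3)) t) x))) ≤
      ENNReal.ofReal ((0 : ℝ) ^ 2) := by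
  simp [frobeniusNormSq_zero]

/-! ### `H¹` packaging and the uniform step -/

/-- `L²` bounds of orders `0` and `1` give `∫|g|² + ∫|∇g|²_F ≤ (√(G₀ + 3G₁))²`
(`|∇g|²_F ≤ 3‖Dg‖²` in dimension three). [folklore] -/
theorem H1_pack {g : EuclideanSpace ℝ (Fin 3) → EuclideanSpace ℝ (Fin 3)} {G₀ G₁ : ℝ≥0}
    (h0 : ∫⁻ x, ‖iteratedFDeriv ℝ 0 g x‖ₑ ^ 2 ≤ G₀) (h1 : ∫⁻ x, ‖iteratedFDeriv ℝ 1 g x‖ₑ ^ 2 ≤ G₁) :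
    (∫⁻ x, ‖g x‖ₑ ^ 2) + (∫⁻ x, ENNReal.ofReal (frobeniusNormSq (fderiv ℝ g x))) ≤
      ENNReal.ofReal ((Real.sqrt (G₀ + 3 * G₁)) ^ 2) := by
  rw [Real.sq_sqrt (by positivity), ENNReal.ofReal_add (by positivity) (by positivity),
    ENNReal.ofReal_coe_nnreal, ENNReal.ofReal_mul (by norm_num), ENNReal.ofReal_coe_nnreal,
    show ENNReal.ofReal (3 : ℝ) = 3 by norm_num]
  have h0' : ∫⁻ x, ‖g x‖ₑ ^ 2 ≤ G₀ := by
    refine le_of_eq_of_le (lintegral_congr fun x => ?_) h0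
    rw [← ofReal_norm, ← ofReal_norm, norm_iteratedFDeriv_zero]
  refine add_le_add h0' ?_
  calc ∫⁻ x, ENNReal.ofReal (frobeniusNormSq (fderiv ℝ g x))
      ≤ ∫⁻ x, 3 * ‖iteratedFDeriv ℝ 1 g x‖ₑ ^ 2 := lintegral_mono fun x => by
        rw [← ofReal_norm, norm_iteratedFDeriv_one, ofReal_norm]
        exact ofReal_frobeniusNormSq_le_three_mul_enorm_sq _
    _ = 3 * ∫⁻ x, ‖iteratedFDeriv ℝ 1 g x‖ₑ ^ 2 := lintegral_const_mul' _ _ (by norm_num)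
    _ ≤ 3 * G₁ := by gcongr

/-- **One uniform step** (zero force): for `A ≥ 0`, `c, ν, s > 0` there are `h > 0` and `N ≥ 1`
with `s = N h` and Tao's smallness `(A + 0·h)⁴ h ≤ c ν³`. [cite: Tao2011, Thm. 5.4 (ii) (arXiv Thm. 31)] -/
theorem exists_uniform_step {A c ν s : ℝ} (hA : 0 ≤ A) (hc : 0 < c) (hν : 0 < ν) (hs : 0 < s) :
    ∃ h : ℝ, 0 < h ∧ ∃ N : ℕ, 0 < N ∧ s = N * h ∧ (A + 0 * h) ^ 4 * h ≤ c * ν ^ 3 := by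
  set D : ℝ := (A + 1) ^ 4 with hD
  have hDpos : 0 < D := by positivity
  set h₀ : ℝ := min 1 (c * ν ^ 3 / D) with hh₀
  have hh₀pos : 0 < h₀ := lt_min one_pos (div_pos (by positivity) hDpos)
  have hh₀D : D * h₀ ≤ c * ν ^ 3 := by
    have : h₀ ≤ c * ν ^ 3 / D := min_le_right _ _
    rwa [le_div_iff₀ hDpos, mul_comm] at this
  set N : ℕ := ⌈s / h₀⌉₊ with hN
  have hsN : s / h₀ ≤ N := Nat.le_ceil _
  have hNpos' : (0 : ℝ) < N := lt_of_lt_of_le (div_pos hs hh₀pos) hsN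
  have hNpos : 0 < N := by exact_mod_cast hNpos'
  set h : ℝ := s / N with hh
  have hhpos : 0 < h := div_pos hs hNpos'
  have hhh₀ : h ≤ h₀ := by
    rw [hh, div_le_iff₀ hNpos']
    have := mul_le_mul_of_nonneg_left hsN hh₀pos.le
    rw [mul_div_cancel₀ _ hh₀pos.ne'] at this
    linarith [mul_comm h₀ (N : ℝ)]
  refine ⟨h, hhpos, N, hNpos, by rw [hh, mul_div_cancel₀ _ hNpos'.ne'], ?_⟩
  have hA1 : A ≤ A + 1 := by linarith
  calc (A + 0 * h) ^ 4 * h = A ^ 4 * h := by ring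
    _ ≤ D * h := mul_le_mul_of_nonneg_right (pow_le_pow_left₀ hA hA1 4) hhpos.le
    _ ≤ D * h₀ := by gcongr
    _ ≤ c * ν ^ 3 := hh₀D

/-! ### Step 1: Serrin `(2, ∞)` on a closed slab, pressure-free, with the explicit rate -/

/-- **No enstrophy growth beyond `e^{κ M² s}` while `|u| ≤ M` (unforced, classical, pressure-free,
quantitative).** For `ν > 0` there is `κ = κ(ν) ≥ 0` such that every classical solution `(u, p)` of the
unforced Navier–Stokes system on a closed slab `[0, S] × ℝ³` lying in Tao's class
(`HasBoundedSobolevNormsOn`) with `|u| ≤ M` on the slab (`M ≥ 0`) obeys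
`∫ |∇u(s)|² ≤ e^{κ M² s} ∫ |∇u(0)|²` for all `s ∈ [0, S]` — Lemarié-Rieusset 2016 Thm. 11.2 (11.11) at
`r = ∞`, the pressure hypothesis removed by re-gauging through Tao's local existence theorem
(the tree's `ForcedEnstrophyOfSupNorm.exists_piece_rate`, force `0`) and chaining along a uniform
partition of `[0, s]`. [cite: LemarieRieusset2016, Thm. 11.2 (11.11)]
[cite: Tao2011, Thm. 5.4 (ii)+(iv) (arXiv Thm. 31)] -/
theorem exists_enstrophy_rate {ν : ℝ} (hν : 0 < ν) :
    ∃ κ : ℝ, 0 ≤ κ ∧ ∀ ⦃S : ℝ⦄ ⦃u : ℝ → EuclideanSpace ℝ (Fin 3) → EuclideanSpace ℝ (Fin 3)⦄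
      ⦃p : ℝ → EuclideanSpace ℝ (Fin 3) → ℝ⦄, 0 < S →
      IsClassicalNSSolutionOn (Icc 0 S) ν 0 u p → HasBoundedSobolevNormsOn (Icc 0 S) u →
      ∀ ⦃M : ℝ⦄, 0 ≤ M → (∀ t ∈ Icc 0 S, ∀ x, ‖u t x‖ ≤ M) →
      ∀ s ∈ Icc 0 S, ∫⁻ x, ENNReal.ofReal (frobeniusNormSq (fderiv ℝ (u s) x)) ≤
        ENNReal.ofReal (Real.exp (κ * (M ^ 2 * s))) *
          ∫⁻ x, ENNReal.ofReal (frobeniusNormSq (fderiv ℝ (u 0) x)) := by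
  obtain ⟨c, hc, hloc⟩ := tao2011_smooth_local_existence_forced_holds
  obtain ⟨κ, hκ0, hpiece⟩ := ForcedEnstrophyOfSupNorm.exists_piece_rate hν hloc
  refine ⟨κ, hκ0, ?_⟩
  intro S u p hS hsol hub M hM0 hM s hs
  set E : ℝ → ℝ≥0∞ := fun t => ∫⁻ x, ENNReal.ofReal (frobeniusNormSq (fderiv ℝ (u t) x)) with hEdef
  set Φ : ℝ → ℝ≥0∞ := fun σ => ENNReal.ofReal (Real.exp (κ * (M ^ 2 * σ))) * E 0 with hΦdef
  change E s ≤ Φ s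
  have hΦ0 : E 0 ≤ Φ 0 := by
    simp only [hΦdef, mul_zero, Real.exp_zero, ENNReal.ofReal_one, one_mul, le_refl]
  rcases hs.1.eq_or_lt with h0 | hs0
  · rw [← h0]; exact hΦ0
  -- the slab `[0, s]`
  have hsolt : IsClassicalNSSolutionOn (Icc 0 s) ν 0 u p :=
    hsol.mono (Icc_subset_Icc_right hs.2) (uniqueDiffOn_Icc hs0)
  have hubs : HasBoundedSobolevNormsOn (Icc 0 s) u := hub.mono (Icc_subset_Icc_right hs.2)
  obtain ⟨C₀, hC₀⟩ := hubs 0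
  obtain ⟨C₁, hC₁⟩ := hubs 1
  set A : ℝ := Real.sqrt (C₀ + 3 * C₁) with hAdef
  have hA : 0 ≤ A := Real.sqrt_nonneg _
  have hAu : ∀ τ ∈ Icc 0 s, (∫⁻ x, ‖u τ x‖ₑ ^ 2) +
      (∫⁻ x, ENNReal.ofReal (frobeniusNormSq (fderiv ℝ (u τ) x))) ≤ ENNReal.ofReal (A ^ 2) :=
    fun τ hτ => H1_pack (hC₀ τ hτ) (hC₁ τ hτ)
  have hMt : ∀ t ∈ Icc 0 s, ∀ x, ‖u t x‖ ≤ M := fun t ht x => hM t ⟨ht.1, ht.2.trans hs.2⟩ x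
  -- zero force
  have hF₀ : ∀ t : ℝ, 0 ≤ t →
      ∫⁻ x, ‖iteratedFDeriv ℝ 0 ((0 : ℝ → EuclideanSpace ℝ (Fin 3) → EuclideanSpace ℝ (Fin 3)) t)
        x‖ₑ ^ 2 ≤ ((0 : ℝ≥0) : ℝ≥0∞) := fun t _ => lintegral_iteratedFDeriv_zero_force_le 0 t
  have hF₁ : ∀ t : ℝ, 0 ≤ t →
      ∫⁻ x, ‖iteratedFDeriv ℝ 1 ((0 : ℝ → EuclideanSpace ℝ (Fin 3) → EuclideanSpace ℝ (Fin 3)) t)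
        x‖ₑ ^ 2 ≤ ((0 : ℝ≥0) : ℝ≥0∞) := fun t _ => lintegral_iteratedFDeriv_zero_force_le 1 t
  have hBf : ∀ t : ℝ, 0 ≤ t →
      (∫⁻ x, ‖(0 : ℝ → EuclideanSpace ℝ (Fin 3) → EuclideanSpace ℝ (Fin 3)) t x‖ₑ ^ 2) +
      (∫⁻ x, ENNReal.ofReal (frobeniusNormSq
        (fderiv ℝ ((0 : ℝ → EuclideanSpace ℝ (Fin 3) → EuclideanSpace ℝ (Fin 3)) t) x))) ≤
      ENNReal.ofReal ((0 : ℝ) ^ 2) := fun t _ => H1_zero_force_le t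
  obtain ⟨h, hh, N, -, hsN, hsmall⟩ := exists_uniform_step hA hc hν hs0
  -- induction along the pieces `[kh, (k+1)h]`
  have hind : ∀ k : ℕ, (k : ℝ) * h ≤ s → ∀ σ ∈ Icc 0 ((k : ℝ) * h), E σ ≤ Φ σ := by
    intro k
    induction k with
    | zero =>
      intro _ σ hσ
      have hσ0 : σ = 0 := le_antisymm (by simpa using hσ.2) hσ.1
      rw [hσ0]; exact hΦ0
    | succ k ih =>
      intro hk σ hσ
      push_cast at hk hσ
      have hτ0 : 0 ≤ (k : ℝ) * h := by positivity
      have hkh : (k : ℝ) * h ≤ s := by nlinarith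
      by_cases hσk : σ ≤ k * h
      · exact ih hkh σ ⟨hσ.1, hσk⟩
      push Not at hσk
      have hτh : (k : ℝ) * h + h ≤ s := by linarith
      have hσ' : σ - k * h ∈ Ioc 0 h := ⟨by linarith, by linarith [hσ.2]⟩
      have hP := hpiece hsolt hubs Literature.Claims.NS.ClayVariants.isSmoothOnHalfSpace_zero
        Literature.Claims.NS.ClayVariants.hasRapidSpaceTimeDecay_zero hM0 hMt hF₀
        hF₁ hA (le_refl (0 : ℝ)) hAu hBf hh hsmall hτ0 hτh hσ'
      rw [add_sub_cancel] at hP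
      simp only [ENNReal.coe_zero, zero_mul, mul_zero, add_zero] at hP
      have hIH : E (k * h) ≤ Φ (k * h) := ih hkh (k * h) ⟨hτ0, le_rfl⟩
      calc E σ ≤ ENNReal.ofReal (Real.exp (κ * (M ^ 2 * (σ - k * h)))) * E (k * h) := hP
        _ ≤ ENNReal.ofReal (Real.exp (κ * (M ^ 2 * (σ - k * h)))) * Φ (k * h) := by gcongr
        _ = Φ σ := by
          simp only [hΦdef]
          rw [← mul_assoc, ← ENNReal.ofReal_mul (Real.exp_nonneg _), ← Real.exp_add]
          have : κ * (M ^ 2 * (σ - k * h)) + κ * (M ^ 2 * (k * h)) = κ * (M ^ 2 * σ) := by ring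
          rw [this]
  exact hind N (by rw [hsN]) s ⟨hs.1, by rw [← hsN]⟩

/-! ### Pointwise and slice comparisons `|curl u|² ≍ |∇u|²` -/

/-- `|curl v(x)|² ≤ ‖curlCLM‖² |∇v(x)|²_F` (in `[0, ∞]`). [folklore] -/
theorem enorm_curl_sq_le (v : EuclideanSpace ℝ (Fin 3) → EuclideanSpace ℝ (Fin 3))
    (x : EuclideanSpace ℝ (Fin 3)) :
    ‖curl v x‖ₑ ^ 2 ≤ ENNReal.ofReal (‖curlCLM‖ ^ 2) * ENNReal.ofReal (frobeniusNormSq (fderiv ℝ v x)) := by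
  rw [← ofReal_norm, ← ENNReal.ofReal_pow (norm_nonneg _), ← ENNReal.ofReal_mul (sq_nonneg _)]
  refine ENNReal.ofReal_le_ofReal ?_
  calc ‖curl v x‖ ^ 2 ≤ (‖curlCLM‖ * ‖fderiv ℝ v x‖) ^ 2 :=
        pow_le_pow_left₀ (norm_nonneg _) (Literature.Analysis.FluidPDE.norm_curl_le v x) 2
    _ = ‖curlCLM‖ ^ 2 * ‖fderiv ℝ v x‖ ^ 2 := mul_pow _ _ _
    _ ≤ ‖curlCLM‖ ^ 2 * frobeniusNormSq (fderiv ℝ v x) :=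
        mul_le_mul_of_nonneg_left (sq_opNorm_le_frobeniusNormSq _) (sq_nonneg _)

/-- `∫ |curl v|² ≤ ‖curlCLM‖² ∫ |∇v|²_F`. [folklore] -/
theorem lintegral_enorm_curl_sq_le (v : EuclideanSpace ℝ (Fin 3) → EuclideanSpace ℝ (Fin 3)) :
    ∫⁻ x, ‖curl v x‖ₑ ^ 2 ≤
      ENNReal.ofReal (‖curlCLM‖ ^ 2) * ∫⁻ x, ENNReal.ofReal (frobeniusNormSq (fderiv ℝ v x)) := by
  rw [← lintegral_const_mul' _ _ ENNReal.ofReal_ne_top]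
  exact lintegral_mono fun x => enorm_curl_sq_le v x

end WindowToSlice

end Summit.NavierStokesRegularity.NavierStokesRegularity.Theorems

end
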